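import Summits.BirchSwinnertonDyer.BirchSwinnertonDyer.Theorems.ManinLocalTwoThreeKummerDiamondStepTwoAssembly
import Summits.BirchSwinnertonDyer.BirchSwinnertonDyer.Theorems.ManinLocalTwoThreeKummerDiamondStepTwoOddClass
import Literature.NumberTheory.EllipticCurves.ModularSymbolsManinDrinfeldGeneralProofs
import HarnessLib

/-!
# es's PROPOSITION A (STEP 1–2 of E-es-185) IN THE INDEX-`4` WORLD, MODULO PRINTED FACTS ONLY (T-es-75 ∧ CES ∧ F★): `2⁵ ∣ N` and the Kummer structure
(route `ManinLocalTwoThree`, crux C2 `ManinOddAtFour` stmt-BirchSwinnertonDyer-22967; cell bsd-f2-manin, prover p2 gen 21; LEAD card `kummer_diamond` nodes D3–D6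
CLOSED in the kernel modulo statement-only printed facts; `--supports stmt-BirchSwinnertonDyer-22967`)

The last residual inputs (R) of `propositionA_of_reciprocity` are discharged here: `R_y = π₀(c₀{∞,1/y}_f)` has finite order (Manin–Drinfeld, tree
`exists_nsmul_modularSymbol_mem_periodLattice_holds`; inlined, cf. `KummerSubgroup.isOfFinAddOrder_uniformize_mul_modularSymbol`), and `map_uniformize_modularSymbol_eq_of_index_four`
(`σ(R_y) = R_y` for every `σ ∈ Aut(ℂ/ℚ)` and every Atkin–Lehner splitting: double es g39's `indexFour_kummerDiamondReciprocity`, the diamond half-value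
`w₀(γ)` being `2`-torsion); (T2) and (O) are parts IX–X.  **`propositionA_indexFour`**: for a lattice-optimal `X₀(N)`-datum of a globally minimal `W₀`
with `4 ∣ N` in the index-`4` world `Λ₁ = 2Λ₀`, MODULO the printed facts T-es-75 (`optimalGamma1Parametrization_cuspInv_galoisAction`), CES
(`exists_optimal_gamma1ParametrizationData`) and F★ (`optimalGamma1Parametrization_cusp_rational`): `2⁵ ∣ N` and the whole STEP-2 structure (odd prime
`p ≡ 3 (4)`, Kummer subgroup `{0, h₁, h₂, h₁ + h₂}` with its odd classes `h₁, h₂`, `h₂ = v ⊗ ψ_{−p}`, `h₁ : (ℤ/8)ˣ ⥲ im ϖ`).  Corollary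
**`two_pow_five_dvd_of_index_four`** = es's THEOREM-A («the index-4 world is empty whenever v₂(N) ≤ 4»), modulo the same printed facts.
What is NOT here: PROPOSITION B (STEP 3, the Frey-twist shape: LEAD p759380 `legendre_descent_cases` + the Kummer-sign bridge), hence E-es-185, C2,
Manin's conjecture and BSD are NOT proved.  No definitions, no sorry. [cite: Stevens1982, §1.3 Thm. 1.3.1] [cite: Stevens1989, §2]
[cite: Manin1972, Cor. 3.6] [cite: ConradEdixhovenStein2003, §6.1.2 and §6.2]
-/

set_option autoImplicit false
-- lint-debt: the directory name repeats the summit name (sibling precedent `ManinLocalTwoThreeKummerDiamondStepTwoAssembly.lean`)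
set_option linter.dupNamespace false

noncomputable section

open scoped MatrixGroups
open CongruenceSubgroup WeierstrassCurve Literature.NumberTheory.EllipticCurves Literature.NumberTheory.EllipticCurves.ModularForms

namespace Summit.BirchSwinnertonDyer.BirchSwinnertonDyer.Theorems.ManinLocalTwoThree.StepTwo

variable {W₀ : WeierstrassCurve ℚ} {N : ℕ} [NeZero N]

/-- **(R) `σ(R_y) = R_y`** for `R_y = π₀(c₀·{∞,1/y}_f)`, every `σ ∈ Aut(ℂ/ℚ)` and every coprime splitting `N = Q·y`, in the index-`4` world (double
es g39's `indexFour_kummerDiamondReciprocity`; the diamond half-value is `2`-torsion).  CONDITIONAL on T-es-75 ∧ CES. [cite: Stevens1982, §1.3 Thm. 1.3.1] -/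
theorem map_uniformize_modularSymbol_eq_of_index_four (hSt : optimalGamma1Parametrization_cuspInv_galoisAction)
    (hCES : exists_optimal_gamma1ParametrizationData) [W₀.IsElliptic] [W₀.IsGloballyMinimal] (D₀ : ModularParametrizationData W₀ N)
    (hopt : ∀ z ∈ D₀.L.lattice, ∃ w ∈ periodLattice D₀.f, z = D₀.c * w)
    (h4 : ∀ z : ℂ, z ∈ periodLatticeGamma1 D₀.f ↔ ∃ w ∈ periodLattice D₀.f, z = 2 * w)
    {Q y : ℕ} (hQy : Q * y = N) (hcop : Nat.Coprime Q y) (σ : ℂ ≃ₐ[ℚ] ℂ) :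
    Affine.Point.map (W' := W₀) (σ : ℂ →ₐ[ℚ] ℂ) (D₀.uniformize ((D₀.c : ℂ) * modularSymbol D₀.f (1 / (y : ℚ)))) =
      D₀.uniformize ((D₀.c : ℂ) * modularSymbol D₀.f (1 / (y : ℚ))) := by
  obtain ⟨d, d', hdd', hσ⟩ := exists_inv_pair_of_algEquiv (N := N) σ
  obtain ⟨γ, hγQ, hγy⟩ := exists_gamma0_of_inv hQy hcop hdd'
  have hK := Summit.BirchSwinnertonDyer.Rank1Residual.ManinAdditive.KummerDiamond.indexFour_kummerDiamondReciprocity hSt hCES W₀ D₀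
    hopt h4 σ d d' hdd' hσ Q y hQy hcop γ hγQ hγy
  have h2 : D₀.uniformize ((D₀.c : ℂ) * modularSymbol D₀.f (1 / (y : ℚ))) = 2 • D₀.uniformize ((D₀.c : ℂ) * modularSymbol D₀.f (1 / (y : ℚ)) / 2) := by
    rw [← map_nsmul]; congr 1; rw [nsmul_eq_mul]; push_cast; ring
  rw [h2, map_nsmul, hK, smul_add, two_nsmul (D₀.uniformize ((D₀.c : ℂ) * cuspSymbol D₀.f γ / 2)),
    uniformize_half_cuspSymbol_add_self, add_zero]

/-- **PROPOSITION A in the index-`4` world, modulo T-es-75 ∧ CES ∧ F★ only** (see the module docstring). [cite: Stevens1989, §2] -/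
theorem propositionA_indexFour (hSt : optimalGamma1Parametrization_cuspInv_galoisAction) (hCES : exists_optimal_gamma1ParametrizationData)
    (hF : optimalGamma1Parametrization_cusp_rational) (W₀ : WeierstrassCurve ℚ) [W₀.IsElliptic] [W₀.IsGloballyMinimal]
    (D₀ : ModularParametrizationData W₀ N) (hopt : ∀ z ∈ D₀.L.lattice, ∃ w ∈ periodLattice D₀.f, z = D₀.c * w) (hN4 : 2 ^ 2 ∣ N)
    (h4 : ∀ z : ℂ, z ∈ periodLatticeGamma1 D₀.f ↔ ∃ w ∈ periodLattice D₀.f, z = 2 * w) :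
    ∃ (S₁ : (W₀.baseChange ℂ).toAffine.Point) (𝒱 : AddSubgroup ((ℂ ≃ₐ[ℚ] ℂ) → (W₀.baseChange ℂ).toAffine.Point)),
      2 • (2 • S₁) = 0 ∧ Affine.Point.map (W' := W₀) ((Complex.conjAe.restrictScalars ℚ : ℂ ≃ₐ[ℚ] ℂ) : ℂ →ₐ[ℚ] ℂ) S₁ ≠ S₁ ∧
      (∀ S : (W₀.baseChange ℂ).toAffine.Point, 2 • (2 • S) = 0 →
        (fun σ : ℂ ≃ₐ[ℚ] ℂ ↦ Affine.Point.map (W' := W₀) (σ : ℂ →ₐ[ℚ] ℂ) S - S) ∈ 𝒱) ∧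
      (∀ Q y : ℕ, Q * y = N → Nat.Coprime Q y →
        (fun σ : ℂ ≃ₐ[ℚ] ℂ ↦ Affine.Point.map (W' := W₀) (σ : ℂ →ₐ[ℚ] ℂ) (D₀.uniformize ((D₀.c : ℂ) * modularSymbol D₀.f (1 / (y : ℚ)) / 2)) -
          D₀.uniformize ((D₀.c : ℂ) * modularSymbol D₀.f (1 / (y : ℚ)) / 2)) ∈ 𝒱) ∧
      ((fun σ : ℂ ≃ₐ[ℚ] ℂ ↦ Affine.Point.map (W' := W₀) (σ : ℂ →ₐ[ℚ] ℂ) S₁ - S₁) ∈ 𝒱) ∧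
    (
      2 ^ 5 ∣ N ∧
      ∃ (p a b y₂ yp : ℕ) (v : (W₀.baseChange ℂ).toAffine.Point) (h₁ h₂ : (ℂ ≃ₐ[ℚ] ℂ) → (W₀.baseChange ℂ).toAffine.Point),
        p.Prime ∧ p ≠ 2 ∧ p % 4 = 3 ∧ 5 ≤ a ∧ 1 ≤ b ∧ 2 ^ a * y₂ = N ∧ Nat.Coprime (2 ^ a) y₂ ∧ p ^ b * yp = N ∧ Nat.Coprime (p ^ b) yp ∧
        v ≠ 0 ∧ (∃ γ : Gamma0 N, D₀.uniformize ((D₀.c : ℂ) * cuspSymbol D₀.f γ / 2) = v) ∧ h₁ ∈ 𝒱 ∧ h₂ ∈ 𝒱 ∧ h₁ ≠ h₂ ∧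
        h₁ (Complex.conjAe.restrictScalars ℚ) = v ∧ h₂ (Complex.conjAe.restrictScalars ℚ) = v ∧
        (∀ f ∈ 𝒱, f = 0 ∨ f = h₁ ∨ f = h₂ ∨ f = h₁ + h₂) ∧ (∀ f ∈ 𝒱, f (Complex.conjAe.restrictScalars ℚ) ≠ 0 → f = h₁ ∨ f = h₂) ∧
        (∀ (σ : ℂ ≃ₐ[ℚ] ℂ) (d d' : ℤ), ((d * d' : ℤ) : ZMod N) = 1 →
          σ (Complex.exp (2 * Real.pi * Complex.I / N)) = Complex.exp (2 * Real.pi * Complex.I * d / N) → ∀ γ : Gamma0 N,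
          ((((γ : SL(2, ℤ)) 1 1 : ℤ)) : ZMod (2 ^ a)) = (d' : ZMod (2 ^ a)) → ((((γ : SL(2, ℤ)) 1 1 : ℤ)) : ZMod y₂) = 1 →
            h₁ σ = D₀.uniformize ((D₀.c : ℂ) * cuspSymbol D₀.f γ / 2)) ∧
        (∀ (σ : ℂ ≃ₐ[ℚ] ℂ) (d d' : ℤ), ((d * d' : ℤ) : ZMod N) = 1 →
          σ (Complex.exp (2 * Real.pi * Complex.I / N)) = Complex.exp (2 * Real.pi * Complex.I * d / N) → ∀ γ : Gamma0 N,
          ((((γ : SL(2, ℤ)) 1 1 : ℤ)) : ZMod (p ^ b)) = (d' : ZMod (p ^ b)) → ((((γ : SL(2, ℤ)) 1 1 : ℤ)) : ZMod yp) = 1 →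
            h₂ σ = D₀.uniformize ((D₀.c : ℂ) * cuspSymbol D₀.f γ / 2)) ∧
        (∀ (σ : ℂ ≃ₐ[ℚ] ℂ) (d d' : ℤ), ((d * d' : ℤ) : ZMod N) = 1 →
          σ (Complex.exp (2 * Real.pi * Complex.I / N)) = Complex.exp (2 * Real.pi * Complex.I * d / N) → (h₂ σ = 0 ↔ IsSquare ((d : ZMod p)))) ∧
        (∀ σ : ℂ ≃ₐ[ℚ] ℂ, h₂ σ = 0 ∨ h₂ σ = v) ∧
        (∀ (σ τ : ℂ ≃ₐ[ℚ] ℂ) (d d' e e' : ℤ), ((d * d' : ℤ) : ZMod N) = 1 →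
          σ (Complex.exp (2 * Real.pi * Complex.I / N)) = Complex.exp (2 * Real.pi * Complex.I * d / N) → ((e * e' : ℤ) : ZMod N) = 1 →
          τ (Complex.exp (2 * Real.pi * Complex.I / N)) = Complex.exp (2 * Real.pi * Complex.I * e / N) →
          (h₁ σ = h₁ τ ↔ (d : ZMod 8) = (e : ZMod 8))) ∧
        (∀ γ : Gamma0 N, ∃ σ : ℂ ≃ₐ[ℚ] ℂ, h₁ σ = D₀.uniformize ((D₀.c : ℂ) * cuspSymbol D₀.f γ / 2))
    ) := by
  obtain ⟨S₁, hS₁2, hS₁tors, hS₁fix, hS₁odd⟩ := exists_odd_quarterPoint_of_index_four hF hCES D₀ hopt hN4 h4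
  -- Manin–Drinfeld: `R_y = π₀(c₀{∞,1/y})` has finite order (cf. the tree's `KummerSubgroup.isOfFinAddOrder_uniformize_mul_modularSymbol`)
  have htors : ∀ r : ℚ, IsOfFinAddOrder (D₀.uniformize ((D₀.c : ℂ) * modularSymbol D₀.f r)) := by
    intro r
    obtain ⟨n, hn, hmem⟩ := exists_nsmul_modularSymbol_mem_periodLattice_holds D₀.f r
    refine isOfFinAddOrder_iff_nsmul_eq_zero.mpr ⟨n, hn, ?_⟩
    rw [← map_nsmul, D₀.uniformize_eq_zero_iff, nsmul_eq_mul, show (n : ℂ) * ((D₀.c : ℂ) * modularSymbol D₀.f r) =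
      (D₀.c : ℂ) * (n • modularSymbol D₀.f r) by rw [nsmul_eq_mul]; ring]
    exact D₀.smul_periodLattice_le _ hmem
  obtain ⟨𝒱, h𝒱⟩ := propositionA_of_reciprocity hSt hCES W₀ D₀ hopt h4
    (fun Q y _ _ ↦ htors _)
    (fun Q y hQy hcop σ ↦ map_uniformize_modularSymbol_eq_of_index_four hSt hCES D₀ hopt h4 hQy hcop σ)
    (fun S hS σ ↦ twoTorsion_fixed_of_index_four hF hCES D₀ hopt hN4 h4 S hS σ) S₁ hS₁tors hS₁fix hS₁odd
  exact ⟨S₁, 𝒱, hS₁2, hS₁odd, h𝒱⟩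

/-- **THEOREM-A (es §4 corollary): in the index-`4` world `2⁵ ∣ N`** — the index-`4` world is EMPTY at every level with `v₂(N) ≤ 4` — MODULO the printed
facts T-es-75 ∧ CES ∧ F★.  Nothing about C2, Manin's conjecture or BSD is proved. [cite: Stevens1989, §2] [cite: Stevens1982, §1.3 Thm. 1.3.1] -/
theorem two_pow_five_dvd_of_index_four (hSt : optimalGamma1Parametrization_cuspInv_galoisAction) (hCES : exists_optimal_gamma1ParametrizationData)
    (hF : optimalGamma1Parametrization_cusp_rational) (W₀ : WeierstrassCurve ℚ) [W₀.IsElliptic] [W₀.IsGloballyMinimal]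
    (D₀ : ModularParametrizationData W₀ N) (hopt : ∀ z ∈ D₀.L.lattice, ∃ w ∈ periodLattice D₀.f, z = D₀.c * w) (hN4 : 2 ^ 2 ∣ N)
    (h4 : ∀ z : ℂ, z ∈ periodLatticeGamma1 D₀.f ↔ ∃ w ∈ periodLattice D₀.f, z = 2 * w) : 2 ^ 5 ∣ N := by
  obtain ⟨-, -, -, -, -, -, -, h5, -⟩ := propositionA_indexFour hSt hCES hF W₀ D₀ hopt hN4 h4
  exact h5

end Summit.BirchSwinnertonDyer.BirchSwinnertonDyer.Theorems.ManinLocalTwoThree.StepTwo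

end
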